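import Mathlib
import Literature.Computability.Complexity.OccurrenceObstructionsIPProofs
import Literature.Computability.Complexity.PlethysmStabilityBIP
import Summits.ValiantsHypothesis.ValiantsHypothesis.Theorems.GeneratorObstructionsGenInheritanceUpper
import Summits.ValiantsHypothesis.ValiantsHypothesis.Theorems.ValuativeGCTValuativeFlipRayStabilityPlethysm
import Summits.ValiantsHypothesis.ValiantsHypothesis.Theorems.ValuativeGCTValuativeFlipRayStabilityKronecker
import HarnessLib

/-!
# `ValuativeGCT.ValuativeFlip` (stmt-ValiantsHypothesis-12624): the Kadish–Landsberg lift is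
# SURJECTIVE in the stable range `λ₂ ≤ m` — rays from the bottom, I

Wall-breaker k4 (gen 1, seat 2; axis "representation-stability transfer between `m` and `m + 1`"),
helper file `--supports stmt-ValiantsHypothesis-12624`.

Along a Kadish–Landsberg ray `j ↦ λ♯(m+j)` (`jδ` boxes added to the first row, level `m + j`)
every transfer landed so far on this axis moves highest-weight vectors UP the ray through the lift
`L = liftHWV m j : ℂ[Sym^m ℂ^{m²}] → ℂ[Sym^{m+j} ℂ^{(m+j)²}]` (rename along the final segment,
then BIP's inner lift at the top variable): `L` is injective (`liftHWV_injective`, k16) and maps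
`HWV_{λ*}` into `HWV_{(λ♯(m+j))*}` (`liftHWV_mem_highestWeightSpace`, IP17 Prop. 2.6(b)).

* `exists_liftHWV_eq` — **for `λ ⊢ m·δ` with at most `m²` parts and SECOND ROW `λ₂ ≤ m`, the lift
  is SURJECTIVE onto `HWV_{(λ♯(m+j))*}` for every `j`**: a highest-weight vector of weight
  `(λ♯(m+j))*` on `ℂ[Sym^{m+j} ℂ^{(m+j)²}]` is an inner lifting from inner degree `m`
  (BIP Prop. 5.6(2), tree theorem `bip2019_prop_5_6_2_holds`; its second hypothesis
  `λ₂ + |λ̄| ≤ mδ` is automatic, being `λ₂ ≤ λ₁`), the inner form has weight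
  `(λ*) extended by zero along the segment` (`mem_highestWeightSpace_of_innerLift_mem`,
  `partitionWeightLex_rowLift`), hence is a renamed highest-weight vector of `ℂ[Sym^m ℂ^{m²}]`
  (`GenInheritance.exists_rename_eq_of_mem_highestWeightSpace_coordRep`, torus-weight descent).
* `map_liftHWV_highestWeightSpace_eq` — so `L(HWV_{λ*}) = HWV_{(λ♯(m+j))*}`: the lift is a linear
  BIJECTION between the two highest-weight spaces (with k16's injectivity).
* `plethysmCoeff_rowLift_eq` — **exact inner plethysm stability with the effective threshold
  `λ₂ ≤ m`**: `a_{λ♯(m+j)}(δ[m+j]) = a_λ(δ[m])` for EVERY `j ≥ 0` (k16's `plethysm_ray_mono` gave `≤`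
  and eventual constancy without a threshold).

Part II (`…LiftKernel`) characterises `L G ∈ I(Δ_{m+j}(X₀₀^{m+j-n} per_n))` by the vanishing of the
Δ_j-twisted evaluation of `G` at level `m`; Part III (`…RayFromBottom`) concludes that the per-side
multiplicity at EVERY position of the ray is decided at the bottom:
`mult_{(λ♯(m+j))*} ℂ[Δ_{m+j}(X₀₀^{m+j-n} per_n)] + dim K_j(λ) = a_λ(δ[m])`.

Sources: Bürgisser–Ikenmeyer–Panova, J. AMS 32 (2019) Lemma 5.3, Prop. 5.6(2); Ikenmeyer–Panova,
Adv. Math. 319 (2017) Prop. 2.6(b); Kadish–Landsberg, Commun. Algebra 42 (2014) §1; Weintraub 1990,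
Brion 1993 (inner plethysm stability); BLMW 2011 §5.4 (inheritance), §6.4.
-/

set_option linter.dupNamespace false

namespace Summit.ValiantsHypothesis.ValiantsHypothesis.Theorems.ValuativeFlip

open MvPolynomial
open Literature.NumberTheory.DiophantineGeometry
open Literature.Computability.AlgebraicComplexity
open Literature.Computability.Complexity

noncomputable section

/-! ## Partition bookkeeping -/

/-- Partitions with the same parts have the same sorted parts. [folklore] -/
theorem ls_sortedParts_congr {D D' : ℕ} {lam : Nat.Partition D} {lam' : Nat.Partition D'}
    (h : lam.parts = lam'.parts) : lam.sortedParts = lam'.sortedParts := by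
  simp only [Nat.Partition.sortedParts, h]

/-- Partitions with the same parts have the same matrix weight `partitionWeightLex`. [folklore] -/
theorem ls_partitionWeightLex_congr (M : ℕ) {D D' : ℕ} {lam : Nat.Partition D} {lam' : Nat.Partition D'}
    (h : lam.parts = lam'.parts) : partitionWeightLex M lam = partitionWeightLex M lam' := by
  funext y
  rw [partitionWeightLex_apply, partitionWeightLex_apply, ls_sortedParts_congr h]

/-- The second row is at most the first row: `λ.sortedParts[1] ≤ λ.sortedParts[0]`. [folklore] -/
theorem ls_getD_one_le_getD_zero {D : ℕ} (lam : Nat.Partition D) :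
    lam.sortedParts.getD 1 0 ≤ lam.sortedParts.getD 0 0 :=
  antitone_getD_sortedParts lam (Nat.zero_le 1)

/-- `λ♯(m+j)` has at most `(m+j)²` parts when `λ` has at most `m²` parts (`m ≠ 0`). [folklore] -/
theorem ls_card_parts_rowLift_le {m δ : ℕ} [NeZero m] (lam : Nat.Partition (m * δ))
    (hlam : lam.parts.card ≤ m * m) (j : ℕ) :
    (rowLift lam j).parts.card ≤ (m + j) * (m + j) :=
  (card_parts_rowLift_le lam j).trans (max_le (hlam.trans (Nat.mul_le_mul (Nat.le_add_right m j)
    (Nat.le_add_right m j))) (Nat.one_le_iff_ne_zero.2 (mul_ne_zero (by have := NeZero.ne m; omega)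
      (by have := NeZero.ne m; omega))))

/-! ## Surjectivity of the lift onto `HWV_{(λ♯(m+j))*}` for `λ₂ ≤ m` -/

/-- **The Kadish–Landsberg lift is surjective in the stable range.**  For `m ≥ 1`, `λ ⊢ m·δ` with at
most `m²` parts and second row `λ₂ ≤ m`, and every `j`: every highest-weight vector `h` of weight
`(λ♯(m+j))*` on `ℂ[Sym^{m+j} ℂ^{(m+j)²}]` is `liftHWV m j F` for a highest-weight vector `F` of weight
`λ*` on `ℂ[Sym^m ℂ^{m²}]`.  Proof: BIP Prop. 5.6(2) (`bip2019_prop_5_6_2_holds`, inner degrees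
`m ≤ m + j` inside `GL_{(m+j)²}`; hypotheses `λ₂ ≤ m` and `λ₂ + |λ̄| ≤ mδ ⟸ λ₂ ≤ λ₁`) writes
`h = innerLift f`; by injectivity of the inner lift `f` has weight
`(λ♯)* + jδ ε_top = ext_segment(λ*)` (`mem_highestWeightSpace_of_innerLift_mem`,
`partitionWeightLex_rowLift`), so `f` is a polynomial in the coordinates of segment monomials and
descends to `ℂ[Sym^m ℂ^{m²}]` (`exists_rename_eq_of_mem_highestWeightSpace_coordRep`).
[Bürgisser–Ikenmeyer–Panova 2019 Prop. 5.6(2), Lemma 5.3; BLMW 2011 §5.4] -/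
theorem exists_liftHWV_eq {m δ : ℕ} [NeZero m] (lam : Nat.Partition (m * δ))
    (hlam : lam.parts.card ≤ m * m) (h₂ : lam.sortedParts.getD 1 0 ≤ m) (j : ℕ) [NeZero (m + j)]
    {h : MvPolynomial (DegIdx (MatIdx (m + j)) (m + j)) ℂ}
    (hh : h ∈ highestWeightSpace (coordRep (MatIdx (m + j)) ℂ (m + j))
      (partitionWeightLex (m + j) (rowLift lam j))) :
    ∃ F ∈ highestWeightSpace (coordRep (MatIdx m) ℂ m) (partitionWeightLex m lam), liftHWV m j F = h := by
  have hmN : m ≤ m + j := Nat.le_add_right m j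
  -- transport `λ♯` to a partition of `δ·(m+j)` (BIP's typing)
  obtain ⟨lamT, hparts⟩ := exists_partition_parts_eq (rowLift lam j) (mul_comm (m + j) δ)
  have hw : partitionWeightLex (m + j) lamT = partitionWeightLex (m + j) (rowLift lam j) :=
    ls_partitionWeightLex_congr _ hparts
  have hcardR : (rowLift lam j).parts.card ≤ (m + j) * (m + j) := ls_card_parts_rowLift_le lam hlam j
  have hlamT : lamT.parts.card ≤ (m + j) * (m + j) := by rw [hparts]; exact hcardR
  -- the two numerical hypotheses of BIP Prop. 5.6(2)
  have hsec : secondPart lamT = lam.sortedParts.getD 1 0 := by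
    rw [secondPart_eq_getD_sortedParts_one, ls_sortedParts_congr hparts, getD_sortedParts_rowLift]
    simp
  have h₂T : secondPart lamT ≤ m := by rw [hsec]; exact h₂
  have hbodyT : secondPart lamT + bodySize lamT ≤ m * δ := by
    have hsupT : lamT.parts.sup = lam.parts.sup + j * δ := by
      rw [sup_parts_eq_getD_sortedParts, ls_sortedParts_congr hparts, getD_sortedParts_rowLift,
        sup_parts_eq_getD_sortedParts]
      simp
    have h12 : lam.sortedParts.getD 1 0 ≤ lam.parts.sup := by
      rw [sup_parts_eq_getD_sortedParts]; exact ls_getD_one_le_getD_zero lam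
    have hsuple : lam.parts.sup ≤ m * δ := sup_parts_le lam
    unfold bodySize
    rw [hsec, hsupT]
    have : δ * (m + j) = m * δ + j * δ := by ring
    rw [this]
    omega
  -- `h` is a form of degree `δ`
  have hhom : h.IsHomogeneous δ :=
    isHomogeneous_of_mem_highestWeightSpace (NeZero.ne (m + j)) hh (size_partitionWeightLex' _ hcardR)
  have hh' : h ∈ highestWeightSpace (coordRep (MatIdx (m + j)) ℂ (m + j)) (partitionWeightLex (m + j) lamT) := by
    rw [hw]; exact hh
  -- BIP Prop. 5.6(2): `h` is an inner lifting from inner degree `m`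
  obtain ⟨-, f, -, -, hf, -, hfeq⟩ :=
    bip2019_prop_5_6_2_holds (m + j) m (m + j) δ hmN lamT hlamT h₂T hbodyT h hhom hh'
  -- the weight of `f` (injectivity of the inner lift), rewritten as `λ*` extended by zero
  have hfw : f ∈ highestWeightSpace (coordRep (MatIdx (m + j)) ℂ m)
      (partitionWeightLex (m + j) (rowLift lam j) +
        Pi.single (topMatIdx (m + j)) ((((m + j - m) * δ : ℕ)) : ℤ)) :=
    mem_highestWeightSpace_of_innerLift_mem (topMatIdx (m + j)) (le_topMatIdx (m + j)) hmN hf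
      (by rw [← hfeq]; exact hh)
  have hwt : partitionWeightLex (m + j) (rowLift lam j) +
        Pi.single (topMatIdx (m + j)) ((((m + j - m) * δ : ℕ)) : ℤ) =
      Function.extend (segEmb hmN) (partitionWeightLex m lam) 0 := by
    rw [← partitionWeightLex_rowLift lam hlam j, add_assoc, ← Pi.single_add, Nat.add_sub_cancel_left,
      neg_add_cancel, Pi.single_zero, add_zero]
  rw [hwt] at hfw
  -- descent along the segment
  obtain ⟨F, hF, hFf⟩ := GenInheritance.exists_rename_eq_of_mem_highestWeightSpace_coordRep (k := ℂ)
    (segEmb_strictMono hmN) (isUpperSet_range_segEmb hmN) hfw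
  refine ⟨F, hF, ?_⟩
  rw [liftHWV, AlgHom.comp_apply, hFf, hfeq]

/-- **The lift is a bijection of highest-weight spaces in the stable range**:
`L(HWV_{λ*}) = HWV_{(λ♯(m+j))*}` for `λ₂ ≤ m` (`⊆`: `liftHWV_mem_highestWeightSpace`; `⊇`:
`exists_liftHWV_eq`). [Bürgisser–Ikenmeyer–Panova 2019 Lemma 5.3, Prop. 5.6(2)] -/
theorem map_liftHWV_highestWeightSpace_eq {m δ : ℕ} [NeZero m] (lam : Nat.Partition (m * δ))
    (hlam : lam.parts.card ≤ m * m) (h₂ : lam.sortedParts.getD 1 0 ≤ m) (j : ℕ) [NeZero (m + j)] :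
    (highestWeightSpace (coordRep (MatIdx m) ℂ m) (partitionWeightLex m lam)).map
        (liftHWV m j).toLinearMap =
      highestWeightSpace (coordRep (MatIdx (m + j)) ℂ (m + j)) (partitionWeightLex (m + j) (rowLift lam j)) := by
  refine le_antisymm ?_ fun h hh => ?_
  · rintro _ ⟨F, hF, rfl⟩
    exact liftHWV_mem_highestWeightSpace lam hlam j hF
  · obtain ⟨F, hF, rfl⟩ := exists_liftHWV_eq lam hlam h₂ j hh
    exact ⟨F, hF, rfl⟩

/-- **Exact inner plethysm stability with the effective threshold `λ₂ ≤ m`.**  For `m ≥ 1`,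
`λ ⊢ m·δ` with at most `m²` parts and `λ₂ ≤ m`, and EVERY `j ≥ 0`:
`a_{λ♯(m+j)}(δ[m+j]) = a_λ(δ[m])` — the lift is an injective (`liftHWV_injective`) linear map of
`HWV_{λ*}` ONTO `HWV_{(λ♯(m+j))*}` (`map_liftHWV_highestWeightSpace_eq`).  (Classical: the
multiplicity of `λ` in `Sym^δ Sym^m V` is stable as soon as `m ≥ λ₂`.)
[Weintraub 1990; Brion 1993; Bürgisser–Ikenmeyer–Panova 2019 Prop. 5.6(2)] -/
theorem plethysmCoeff_rowLift_eq {m δ : ℕ} [NeZero m] (lam : Nat.Partition (m * δ))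
    (hlam : lam.parts.card ≤ m * m) (h₂ : lam.sortedParts.getD 1 0 ≤ m) (j : ℕ) [NeZero (m + j)] :
    plethysmCoeff ℂ (MatIdx (m + j)) (m + j) (partitionWeightLex (m + j) (rowLift lam j)) =
      plethysmCoeff ℂ (MatIdx m) m (partitionWeightLex m lam) := by
  unfold plethysmCoeff hwMultiplicity
  rw [← map_liftHWV_highestWeightSpace_eq lam hlam h₂ j]
  exact LinearEquiv.finrank_eq (Submodule.equivMapOfInjective _
    (liftHWV_injective m j) _).symm

end

end Summit.ValiantsHypothesis.ValiantsHypothesis.Theorems.ValuativeFlip
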